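/-
Copyright (c) 2026 the pub-hodgecm-mathlib formalisation cell (harness21).  Prover seat hodgecm-mathlib-R90-CS-p03 (g3), R90-TF section S8 «ContSpec-n½» (dealer R90-CS-plan (g3),
S8-R215 «`K2E1ChiArchA32LevelChoiceU3` — `exists_levelOfRecord_dvd`»; finding F-A32, repair (R1)): A LEVEL OF RECORD `𝔫 ≠ 0` THAT IS AT ONCE A CONDUCTOR LEVEL OF THE BOREL PAIR
CHARACTER (★ 2b's clause `hKχ` for `K(𝔫)_f = finCongruenceLevel 𝔫`, qualifying for ★ 3d `exists_mem_chiSectionSpacePair_levelOfRecord` ∕ ★ p864141) AND DIVISIBLE BY EVERY PLACE OF `L`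
OVER THE BAD FINSET `S₀` (`|𝔫|_{w′} < 1`, the radius hypothesis of ★ (E-cell) `lowerUnitriangular_mem_borel_mul_valuedCongruence_iff`).
-/
import Summits.HodgeConjecture.HodgeConjecture.Theorems.R90S8ChiSectionPairLevelOfRecordU3   -- ★ p863976 (K2E1-p11 (g4)) 3d: `exists_mem_chiSectionSpacePair_levelOfRecord`, `levelOfRecord`, `omegaOfRecord`; brings ★ 2b `exists_finCongruenceLevel_borelPairChar_eq_one`, ★ `isOpen_finCongruenceLevel`
import Literature.NumberTheory.Automorphic.UnitaryGroupArithmeticLevels                    -- ★ `finCongruenceLevel_mono` (`0 ≠ 𝔫 ≤ 𝔪 ⇒ K_f(𝔫) ≤ K_f(𝔪)`)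
import Literature.NumberTheory.Automorphic.GJUnfoldingData                                  -- ★ `idealRadius_lt_one_of_dvd` (`w ∣ 𝔫 ≠ 0 ⇒ |𝔫|_w < 1`)
import HarnessLib

/-!
# K2·E1 ∕ R90·S8 — `K2E1ChiArchA32LevelChoiceU3`: THE LEVEL OF RECORD `𝔫 := 𝔫_cond · ∏_{v ∈ S₀} ∏_{w′ ∣ v} 𝔭_{w′}` — A CONDUCTOR LEVEL DIVISIBLE BY THE BAD PLACES

Cell `pub/hodgecm-mathlib`, crux h413 = `stmt-HodgeConjecture-24833`, route of record `HCCMUnconditional`; R90-TF section S8 «ContSpec-n½», road R2-χ₃ ((V) OF RECORD rows (i) and (iii):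
the witness level and `hA32` at the moved base point, F-A32 (R1)).  THEOREMS ONLY (no `def`, no `instance`, no notation, no named-fact hypothesis, no `sorry`; default heartbeats); lane
`--supports stmt-HodgeConjecture-24833 --as helper` (count-neutral).  Closes no socket.

WHY.  (V) OF RECORD ED. 4∕5 (K2E1-p16) read the intertwined witness at the base point `g₁ := ι_f(w₀^{S₀})`; the identification of the witness's bad-place weights with the 𝔫-ball test
weights of ★ p864319∕p864366 uses ★ (E-cell) (`K2E1BigCellConjugateCongruenceU3`, radius `c < 1`, i.e. `w′ ∣ 𝔫` at every place `w′` of `L` over `v ∈ S₀`) and ★ (E-supp) (the finite-level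
section at a CONDUCTOR level `Kf = K(𝔫)_f`, clause `hKχ : χ₁(k₀₀)·χ₂(k₁₁) = 1` for Borel `k ∈ Kf`, ★ 2b `exists_finCongruenceLevel_borelPairChar_eq_one`).  Both requirements are met by ONE
level: take 2b's conductor level `𝔫₀ ≠ 0` and set `𝔫 := 𝔫₀ · ∏_{v∈S₀} ∏_{w′∣v} 𝔭_{w′}`; then `𝔫 ≠ 0` (Dedekind domain), `𝔫 ≤ 𝔫₀` so `K(𝔫)_f ≤ K(𝔫₀)_f` (★ `finCongruenceLevel_mono`) and the
conductor clause is inherited, and `𝔭_{w′} ∣ 𝔫` gives `|𝔫|_{w′} < 1` (★ `idealRadius_lt_one_of_dvd`) for every `w′` over `S₀`.  ON THE HAAR CONSTANT `hC : C ≠ 0` of ★ p864319∕p864366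
(dealer's question): it is NOT definitional — `C` is the `∃ C > 0` of ★ (a-2b) `exists_pos_inv_measure_smul_integral_eq_chiEulerProduct_three` (product of Haar normalisations), so the
consumer discharges `hC := hCpos.ne'` at its `obtain ⟨C, hCpos, _⟩`; no separate file is needed.
* §1 `prod_placesOver_asIdeal_ne_zero`, `asIdeal_dvd_prod_placesOver`.
* §2 HEAD **`exists_levelOfRecord_dvd`** — `∃ 𝔫 ≠ 0`, conductor clause for `finCongruenceLevel 𝔫`, `𝔭_{w′} ∣ 𝔫` and `idealRadius L w′ 𝔫 < 1` for all `w′` over `S₀`.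
* §3 **`exists_witness_levelOfRecord_dvd`** — the same `𝔫` with ★ 3d's hypothesis-free witness AT THAT LEVEL (`φ ∈ chiSectionSpacePair χ₁ χ₂ (levelOfRecord K(𝔫)_f) (omegaOfRecord …)`,
  continuous, `φ 1 = 1`, `φ ∘ ι_∞ = archSectionE χ₁ χ₂`) — the (V)(i) witness binder and the (E-cell) radius clause from ONE existential.
HONEST LABEL: HC_CM is proved only modulo the 7 printed citations (2 remaining named inputs: hLiu418 = `stmt-HodgeConjecture-24832`, h413 = `stmt-HodgeConjecture-24833`) until rung 0
closes; REL ≠ ★ ≠ BUILT; this file asserts no named fact and closes no socket; unconditional; count-neutral.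

## References
* [PlatonovRapinchuk1994] V. Platonov, A. Rapinchuk, *Algebraic Groups and Number Theory* (1994), §5.1 (congruence subgroups of adelic groups).
* [MoeglinWaldspurger1995] C. Mœglin, J.-L. Waldspurger, *Spectral Decomposition and Eisenstein Series* (1995), I.2.17.
* [BorelJacquet1979] A. Borel, H. Jacquet, *Automorphic forms and automorphic representations*, Corvallis PSPM 33.1 (1979), §4.1.
-/

set_option autoImplicit false
set_option linter.dupNamespace false -- the mandated namespace repeats `HodgeConjecture.HodgeConjecture`

noncomputable section

open NumberField IsDedekindDomain Topology Filter
open Literature.NumberTheory.Automorphic Literature.NumberTheory.Automorphic.UnitaryGroup Literature.NumberTheory.GaloisRepresentations AdelicGroupData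
open Literature.NumberTheory.Automorphic.Arthur2013.Leaves.TECR
open Summit.HodgeConjecture.HodgeConjecture.Cruxes.H413.K2E1CharacterEisensteinU2Defs
open Summit.HodgeConjecture.HodgeConjecture.Cruxes.H413.K2E1CharacterEisensteinU3PairDefs
open Summit.HodgeConjecture.HodgeConjecture.Cruxes.H413.K2E1ChiSectionSpaceU3PairDefs
open Summit.HodgeConjecture.HodgeConjecture.R90.S8 (exists_finCongruenceLevel_borelPairChar_eq_one exists_mem_chiSectionSpacePair_levelOfRecord levelOfRecord omegaOfRecord archSectionE)

namespace Summit.HodgeConjecture.HodgeConjecture.Cruxes.H413.K2E1ChiArchA32LevelChoiceU3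

variable (L : Type) [Field L] [NumberField L] [IsCMField L]

/-! ## §1 The product of the primes of `L` over a finset of places of `L⁺` -/

omit [IsCMField L] in
/-- **`∏_{v ∈ S₀} ∏_{w′ ∣ v} 𝔭_{w′} ≠ 0`** (a finite product of non-zero primes in the Dedekind domain `𝓞_L`). [folklore] -/
theorem prod_placesOver_asIdeal_ne_zero (S₀ : Finset (HeightOneSpectrum (𝓞 ↥(maximalRealSubfield L)))) :
    (∏ v ∈ S₀, ∏ w' : PlacesOver L v, w'.1.asIdeal) ≠ 0 :=
  Finset.prod_ne_zero_iff.2 fun v _ => Finset.prod_ne_zero_iff.2 fun w' _ => by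
    rw [Ne, Ideal.zero_eq_bot]
    exact w'.1.ne_bot

omit [IsCMField L] in
/-- **`𝔭_{w′} ∣ ∏_{v ∈ S₀} ∏_{w″ ∣ v} 𝔭_{w″}`** for `v ∈ S₀` and `w′ ∣ v`. [folklore] -/
theorem asIdeal_dvd_prod_placesOver (S₀ : Finset (HeightOneSpectrum (𝓞 ↥(maximalRealSubfield L)))) {v : HeightOneSpectrum (𝓞 ↥(maximalRealSubfield L))} (hv : v ∈ S₀)
    (w' : PlacesOver L v) : w'.1.asIdeal ∣ ∏ u ∈ S₀, ∏ w'' : PlacesOver L u, w''.1.asIdeal := by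
  have h1 : w'.1.asIdeal ∣ ∏ w'' : PlacesOver L v, w''.1.asIdeal :=
    Finset.dvd_prod_of_mem (fun w'' : PlacesOver L v => w''.1.asIdeal) (Finset.mem_univ w')
  have h2 : (∏ w'' : PlacesOver L v, w''.1.asIdeal) ∣ ∏ u ∈ S₀, ∏ w'' : PlacesOver L u, w''.1.asIdeal :=
    Finset.dvd_prod_of_mem (fun u : HeightOneSpectrum (𝓞 ↥(maximalRealSubfield L)) => ∏ w'' : PlacesOver L u, w''.1.asIdeal) hv
  exact h1.trans h2

/-! ## §2 HEAD: the level of record -/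

/-- **HEAD.  THE LEVEL OF RECORD**: for every pair `(χ₁, χ₂)` (a Hecke character of `L`, a character of the `U(1)`-torus) and every finset `S₀` of finite places of `L⁺` there is an ideal
`𝔫 ≠ 0` of `𝓞_L` such that (conductor) `χ₁(k₀₀)·χ₂(k₁₁) = 1` for every `k ∈ K(𝔫)_f` with `ι_f k ∈ B(𝔸)` — ★ 2b's clause `hKχ`, so `K(𝔫)_f` qualifies for ★ FILE 2 ∕ (E-supp) ∕ 3d — and
(divisibility) `𝔭_{w′} ∣ 𝔫`, hence `|𝔫|_{w′} < 1`, for every place `w′` of `L` over a place of `S₀` (the radius hypothesis of ★ (E-cell)).  `𝔫 := 𝔫_cond · ∏_{v∈S₀} ∏_{w′∣v} 𝔭_{w′}`.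
[cite: PlatonovRapinchuk1994, §5.1] [cite: MoeglinWaldspurger1995, I.2.17] -/
theorem exists_levelOfRecord_dvd (χ₁ : HeckeCharacter L) (χ₂ : ↥(TorusDict.torus (IsCMField.complexConj L)) →ₜ* ℂˣ) (S₀ : Finset (HeightOneSpectrum (𝓞 ↥(maximalRealSubfield L)))) :
    ∃ 𝔫 : Ideal (𝓞 L), 𝔫 ≠ 0 ∧
      (∀ k ∈ finCongruenceLevel (↥(maximalRealSubfield L)) L (IsCMField.complexConj L) 3 ((StdForm.antidiagonal 3).over L) 𝔫,
        ∀ (hk : finAdelicToAdelic (↥(maximalRealSubfield L)) L (IsCMField.complexConj L) 3 ((StdForm.antidiagonal 3).over L) k ∈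
          borelAdelic (↥(maximalRealSubfield L)) L (IsCMField.complexConj L) 3),
        ((χ₁ (firstEntryUnit hk) : ℂˣ) : ℂ) * ((χ₂ (middleEntryUnitary hk) : ℂˣ) : ℂ) = 1) ∧
      (∀ v ∈ S₀, ∀ w' : PlacesOver L v, w'.1.asIdeal ∣ 𝔫) ∧
      (∀ v ∈ S₀, ∀ w' : PlacesOver L v, idealRadius L w'.1 𝔫 < 1) := by
  obtain ⟨𝔫₀, h𝔫₀, hKχ⟩ := exists_finCongruenceLevel_borelPairChar_eq_one L χ₁ χ₂
  have hP := prod_placesOver_asIdeal_ne_zero L S₀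
  have h𝔫 : 𝔫₀ * ∏ v ∈ S₀, ∏ w' : PlacesOver L v, w'.1.asIdeal ≠ 0 := mul_ne_zero h𝔫₀ hP
  have hdvd : ∀ v ∈ S₀, ∀ w' : PlacesOver L v, w'.1.asIdeal ∣ 𝔫₀ * ∏ v ∈ S₀, ∏ w' : PlacesOver L v, w'.1.asIdeal :=
    fun v hv w' => dvd_mul_of_dvd_right (asIdeal_dvd_prod_placesOver L S₀ hv w') 𝔫₀
  refine ⟨𝔫₀ * ∏ v ∈ S₀, ∏ w' : PlacesOver L v, w'.1.asIdeal, h𝔫, fun k hk hkB => ?_, hdvd, fun v hv w' => idealRadius_lt_one_of_dvd h𝔫 (hdvd v hv w')⟩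
  -- the conductor clause is inherited from `K(𝔫)_f ≤ K(𝔫₀)_f`
  exact hKχ k (finCongruenceLevel_mono h𝔫 Ideal.mul_le_right hk) hkB

/-! ## §3 The witness of record at the level of record -/

/-- **THE WITNESS OF RECORD AT THE LEVEL OF RECORD**: for every pair `(χ₁, χ₂)` and every bad finset `S₀` there is `𝔫 ≠ 0`, divisible by every place of `L` over `S₀` (`|𝔫|_{w′} < 1`),
carrying ★ 3d's hypothesis-free witness `φ ∈ chiSectionSpacePair χ₁ χ₂ (levelOfRecord K(𝔫)_f) (omegaOfRecord χ₁ χ₂ K(𝔫)_f)`, continuous, `φ 1 = 1`, `φ ∘ ι_∞ = archSectionE χ₁ χ₂` — §2's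
level fed to ★ `exists_mem_chiSectionSpacePair_levelOfRecord` (★ `isOpen_finCongruenceLevel`).  The (V)(i) witness binder and the (E-cell) radius clause from ONE existential.
[cite: MoeglinWaldspurger1995, I.2.17] [cite: BorelJacquet1979, §4.1] -/
theorem exists_witness_levelOfRecord_dvd (χ₁ : HeckeCharacter L) (χ₂ : ↥(TorusDict.torus (IsCMField.complexConj L)) →ₜ* ℂˣ) (S₀ : Finset (HeightOneSpectrum (𝓞 ↥(maximalRealSubfield L)))) :
    ∃ 𝔫 : Ideal (𝓞 L), 𝔫 ≠ 0 ∧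
      (∀ k ∈ finCongruenceLevel (↥(maximalRealSubfield L)) L (IsCMField.complexConj L) 3 ((StdForm.antidiagonal 3).over L) 𝔫,
        ∀ (hk : finAdelicToAdelic (↥(maximalRealSubfield L)) L (IsCMField.complexConj L) 3 ((StdForm.antidiagonal 3).over L) k ∈
          borelAdelic (↥(maximalRealSubfield L)) L (IsCMField.complexConj L) 3),
        ((χ₁ (firstEntryUnit hk) : ℂˣ) : ℂ) * ((χ₂ (middleEntryUnitary hk) : ℂˣ) : ℂ) = 1) ∧
      (∀ v ∈ S₀, ∀ w' : PlacesOver L v, w'.1.asIdeal ∣ 𝔫) ∧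
      (∀ v ∈ S₀, ∀ w' : PlacesOver L v, idealRadius L w'.1 𝔫 < 1) ∧
      ∃ φ : (quasiSplit (↥(maximalRealSubfield L)) L (IsCMField.complexConj L) 3).Adelic → ℂ,
        φ ∈ chiSectionSpacePair χ₁ χ₂ (levelOfRecord L (finCongruenceLevel (↥(maximalRealSubfield L)) L (IsCMField.complexConj L) 3 ((StdForm.antidiagonal 3).over L) 𝔫))
            (omegaOfRecord L χ₁ χ₂ (finCongruenceLevel (↥(maximalRealSubfield L)) L (IsCMField.complexConj L) 3 ((StdForm.antidiagonal 3).over L) 𝔫)) ∧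
          Continuous φ ∧ φ 1 = 1 ∧
            ∀ a : arch (↥(maximalRealSubfield L)) L (IsCMField.complexConj L) 3 ((StdForm.antidiagonal 3).over L),
              φ (archToAdelic (↥(maximalRealSubfield L)) L (IsCMField.complexConj L) 3 ((StdForm.antidiagonal 3).over L) a) = archSectionE L χ₁ χ₂ a := by
  obtain ⟨𝔫, h𝔫, hKχ, hdvd, hrad⟩ := exists_levelOfRecord_dvd L χ₁ χ₂ S₀
  exact ⟨𝔫, h𝔫, hKχ, hdvd, hrad, exists_mem_chiSectionSpacePair_levelOfRecord L χ₁ χ₂ _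
    (isOpen_finCongruenceLevel (↥(maximalRealSubfield L)) L (IsCMField.complexConj L) 3 ((StdForm.antidiagonal 3).over L) h𝔫) hKχ⟩

end Summit.HodgeConjecture.HodgeConjecture.Cruxes.H413.K2E1ChiArchA32LevelChoiceU3

end
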